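import Summits.QuantumFields.BalabanUV.Beta.D1BFx.StraightPinRestRow
import Summits.QuantumFields.BalabanUV.Beta.D1BFx.RoadPinKernelDecay
import Summits.QuantumFields.BalabanUV.Beta.D1BFx.RoadPinKernelBdd
import Summits.QuantumFields.BalabanUV.Beta.D1BFx.SymHessTableMass

/-!
# `BalabanUV.Beta.D1BFx.CombStraightPinRestRowMass` — road «BF-x» for binder row D1, slot (K) ∕ junction (J1), direction RE-TABLE (R-D1-g55-1), PART 24 HEAD row (rest),
# «COMB-REST-ROW-MASS»: **THE COMB TWIN OF «REST-ROW-MASS» — node 12b's PACKED COMB MIXED TABLE `mixFFAt ρ L` (lit) IN `ℓ¹` CURRENCY (its fine-block × full-fibre mass is at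
# most its own reference-block absolute sum `mixAbs ρ L` — NO support count, NO power of `L`) AND THE HEAD's ROW (rest) AT THE COMB TABLE re-priced through it: NET
# `n⁻¹³ × mixAbs ρ_c n × S × CΦ` — the sym row's law, letter for letter, with `symMixFFAt ∕ symMixAbs ↦ mixFFAt ∕ mixAbs`.**

HONEST DEPENDENCY (cell records, verbatim): «continuum YM on T⁴ ⇐ BetaPertH ∧ nine spine estimates (0/9 proved); BetaPertH ⇐ (D1) ∧ (D4) ∧
CAP+tail; G-an2-4 gates asym, D1 and NE2/3/4.»  HONEST FRAMING (cell contract, verbatim): «discharging `BetaPertH` makes Bałaban's UV stability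
UNCONDITIONAL — a real constructive-QFT result; it is NOT the continuum limit and NOT the Clay problem.»  THIS MODULE DISCHARGES NOTHING of the
wall: [folklore] `Finset` ∕ `tsum` bookkeeping BY NAME over LANDED objects — lit node 12b `AveragingMixedJetTables` (`mixFFAt`, `mixKerAt`, `tTab`, `tTab_eq_zero₁∕₂∕₃`
(finite support in all three bonds), `tTab_eq_zero_block` (block covariance), `mixAbs` (the reference-block absolute SUM), `mixAbs_nonneg`, `nearSet ∕ bondSet ∕ near_zero_iff`),
this lineage's g62 F4 `StraightPinRestRow.restRow_K₀_of_blockSlotTotal` (the (rest) pair's row shapes from ANY table's `hPs ∕ hPB` block masses), g62 `RoadPinKernelDecay.decays_K₀_of_blocks`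
+ g63 `RoadPinKernelBdd.bdd_G₀_of_decays` (the leg letter), g63 PART B `SymHessTableMass.mem_image_nearSet'`.  No definition, no `def … : Prop`, nothing cited, 0 sorry, default heartbeats.
Letters DISPLAYED as hypotheses: the (K)-wall's ff letter `hΓ` (§4), the multiplier envelope `hΦ` (dischargeable by d1-leaf-04 g28's `StraightPinMultiplierEnvelope.abs_wΦ_le_hΦ`);
`mixAbs (ctr 4 n) n` is DISPLAYED inside the constant — its n-law is d1-leaf-04 g31's «COMB-MIXED-TABLE-MASS» `MixedTableMass.mixAbs_ctr4_le` (staged; X1 PASS), NOT asserted here.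
An INTERMEDIATE per-word letter: ONE of eight rows, at the supplier's table, BELOW the OWNER's comb pin (RETABLE-SPEC-g28 — not typed yet); NOT the HEAD; NOT a binder; 0∕4 row-D1
binders (hW ∕ hR-sockets ∕ hSX-socket ∕ D1Tel ∕ D1Rep); (J1) ONE OPEN ROW; (K) NOT closed; NOT D1, NEVER «G-an2-4 closed», NOT `BetaPertH`, NOT continuum, NOT Clay.

ABSOLUTE RULE (cell charter, verbatim): «No internally-minted statement may enter as a cited fact. Every hypothesis is either kernel-proved in
this package or a verbatim quotation of a PUBLISHED theorem with page reference. The manuscript(s) under audit are NOT citable for their own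
disputed steps — they are the thing under adjudication; programme-internal (2001/route/tribunal) claims are never citable.»

WHY (an2 g55 RULING R-D1-g55-1 l.60499: RE-TABLE FINAL, the road carries the comb record — `mixFF := mixFFAt ρ_c` — at `G₀`; the OWNER's pin identity `ChartDefectTwoPinsRest.tadpole_rest_record_eq`
is table-generic, so the comb HEAD's (rest) row reduces to THIS pair exactly as the sym HEAD's reduced to g63's `StraightPinRestRowMass`).  g63's file (p372101 ✓) is NOT imported (no
hub olean at typing time): its two table-free helpers are taken from PART B (`mem_image_nearSet'`) or re-proved under a new name (`l1_sub_le_of_near_block`).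

CONTENT.
* §1 [folklore, generic `d`, root offset `r ∈ box (d+1) L`]: `blk_mixFFAt_eq_zero` (off ff), `blk_mixFFAt_tt` (`rfl`), `fibreMass_blk_mixFFAt_eq_zero`, **`summable_fibreMass_blk_mixFFAt`** (`hPs`),
  `tsum_fibreMass_blk_mixFFAt_eq`, **`boxSum_fibreMass_tt_le_mixAbs`** (`Σ_{b ∈ box} Σ_{(x,x′) ∈ near(y)²} Σ_{α α′} |t_{(μ,y)}((α,x),(α′,x′);(κ, L•y₁ + b))| ≤ mixAbs ρ L`),
  `l1_sub_le_of_near_block`, **`boxSum_tsum_fibreMass_blk_mixFFAt_le`** (`hPB`: `≤ (if j ∧ i then mixAbs·e^{θ(d+1)} else 0)·e^{−θ|y − y₁|₁}`, any `0 ≤ θ`).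
* §2 [`d = 3`, `[NeZero n]`, the comb table at the centred root `mixFFAt (ctr 4 n) n` BY NAME]: **`hPs_comb`**, **`hPB_comb`**.  (an2's record field `M2Of 3 n (combTablesAn1S2 …).mixFF 0`
  is this table — weight `wM2 3 n 0 = 1`, field `rfl` — a bridge the consumer writes once `CombTablesAn1` lands; not imported here.)
* §3 **`restRow_comb_mass`**: the (rest) pair's row shapes at the comb table, modulo a displayed leg letter `Bdd G S` — g62 `restRow_K₀_of_blockSlotTotal` fed with §2.
* §4 **`restRow_comb_head`**: §3 at the HEAD's literal leg `G₀ := coDressKBmAt (ctr 4 n) n K₀`, `hG := bdd_G₀_of_decays n (decays_K₀_of_blocks n …)` — the ONLY displayed letters left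
  are `hΓ` and `hΦ`; `S = (1 + 4·(4·n))²·(CΓ + 2·(n⁵)⁻¹C₄e^{κ′} + CΦ(n⁵)⁻¹(n³)⁻¹e^{κ₀})`.
NOT HERE (honest): the n-law of `mixAbs (ctr 4 n) n` (leaf-04's `MixedTableMass`); the comb HEAD's pin and the scales ∕ free steps (twins of g64's `ChartDefectRowRestScales[Free]` —
they wait for the OWNER's RETABLE-SPEC-g28); the other seven rows; m-uniformity itself.
Unit `b2b-balaban-gan24-formalise-leaf-05` (gen 65), G-an2-4 swarm leaf prover 05, road «BF-x» supplier, (rest)-row lineage g62–g65; INTENT-3 «COMB-REST-ROW-MASS» (journal l.60715).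
Not in print; our bookkeeping.  No existing file touched.
-/

noncomputable section

open Finset
open scoped BigOperators
open Literature.MathematicalPhysics.QuantumFieldTheory.Balaban1983to89
open Literature.MathematicalPhysics.QuantumFieldTheory.Balaban1983to89.Beta
open B12Sec2to5 (l1 l1_nonneg)
open DecimatedMomentSummable (AbsMoment₂)
open B4ContourShift (supNorm)
open B5Hk163Strip (kappa163 kappa163_pos)
open B5Hk163Decay (MG163)
open B4TorusKernel (periodConst)
open ExpKernelCalculus (Site MKer Zl tadpole)
open AffineAveraging (box toSite)
open AveragingContoursRooted (ctr ctrOff ctrOff_mem_box)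
open AveragingHessianKernels (Near Bond)
open AveragingMixedJetTables (nearSet bondSet mem_nearSet mem_bondSet near_zero_iff mixFFAt mixKerAt tTab mixAbs mixAbs_nonneg tTab_eq_zero₁ tTab_eq_zero₂
  tTab_eq_zero₃ tTab_eq_zero_block mixFFAt_inl_inl mixFFAt_inl_inr mixFFAt_inr)
open KernelSpecInstance (wΦ)
open KernelWard (Bdd)
open OneStepResolventKernel (Fib)
open OneStepKernelFamily (KInvStep)
open SecondOrderResponse (mixOfK)
open Summit.QuantumFields.BalabanUV.Beta.D1BFx.PackedKernelSplit (blk blk_tt blk_tf blk_ft blk_ff)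
open Summit.QuantumFields.BalabanUV.Beta.D1BFx.StraightPinRestRow (restRow_K₀_of_blockSlotTotal)
open Summit.QuantumFields.BalabanUV.Beta.D1BFx.SymHessTableMass (mem_image_nearSet')
open KKTFluctuationKernel (Gam)
open Summit.QuantumFields.BalabanUV.Beta.AxialDressingRooted (coDressKBmAt)
open Summit.QuantumFields.BalabanUV.Beta.D1BFx.RoadPinKernelDecay (decays_K₀_of_blocks)
open Summit.QuantumFields.BalabanUV.Beta.D1BFx.RoadPinKernelBdd (bdd_G₀_of_decays)

namespace Summit.QuantumFields.BalabanUV.Beta.D1BFx.CombStraightPinRestRowMass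

/-! ## §1 node 12b's packed comb mixed table `mixFFAt` in `ℓ¹` currency (generic `d`, root offset `r ∈ box`) -/

section Table

variable {d : ℕ} {r : Fin (d + 1) → ℕ} {L : ℕ}

/-- [folklore] Off the field–field block the packed comb mixed table vanishes. -/
theorem blk_mixFFAt_eq_zero (ρ : Fin (d + 1) → ℤ) (L : ℕ) (κ : Fin (d + 1)) (u : Fin (d + 1) → ℤ) (μ : Fin (d + 1)) (y : Fin (d + 1) → ℤ)
    {j i : Bool} (h : ¬ (j = true ∧ i = true)) : blk (mixFFAt ρ L κ u μ y) j i = 0 := by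
  funext x x' a b
  cases j <;> cases i
  · rfl
  · rfl
  · rfl
  · exact absurd ⟨rfl, rfl⟩ h

/-- [folklore] The field–field block of the packed comb mixed table, entrywise: `t_{(μ,y)}((α,x),(α′,x′);(κ,u))`. -/
theorem blk_mixFFAt_tt (ρ : Fin (d + 1) → ℤ) (L : ℕ) (κ : Fin (d + 1)) (u : Fin (d + 1) → ℤ) (μ : Fin (d + 1)) (y : Fin (d + 1) → ℤ)
    (x x' : Fin (d + 1) → ℤ) (α α' : Fin (d + 1)) :
    blk (mixFFAt ρ L κ u μ y) true true x x' α α' = (tTab ρ L μ y (α, x) (α', x') (κ, u) : ℝ) := rfl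

/-- [folklore] **THE PACKED COMB MIXED TABLE HAS FINITE SUPPORT IN THE SITE PAIR** (lit `tTab_eq_zero₁ ∕ ₂`): the fibre mass of any block vanishes off `near(y) × near(y)`. -/
theorem fibreMass_blk_mixFFAt_eq_zero (hr : r ∈ box (d + 1) L) (κ : Fin (d + 1)) (u : Fin (d + 1) → ℤ) (μ : Fin (d + 1))
    (y : Fin (d + 1) → ℤ) (j i : Bool) {p : Site (d + 1) × Site (d + 1)}
    (hp : p ∉ (nearSet (d + 1) L).image (fun x₀ => x₀ + (L : ℤ) • y) ×ˢ (nearSet (d + 1) L).image (fun x₀ => x₀ + (L : ℤ) • y)) :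
    ∑ g : Fin (d + 1), ∑ f : Fin (d + 1), |blk (mixFFAt (toSite r) L κ u μ y) j i p.1 p.2 g f| = 0 := by
  by_cases hji : j = true ∧ i = true
  · obtain ⟨rfl, rfl⟩ := hji
    rw [Finset.mem_product, not_and_or, mem_image_nearSet', mem_image_nearSet'] at hp
    refine Finset.sum_eq_zero fun g _ => Finset.sum_eq_zero fun f _ => ?_
    rw [blk_mixFFAt_tt]
    rcases hp with h1 | h2
    · rw [tTab_eq_zero₁ hr μ y (f := (g, p.1)) h1, Rat.cast_zero, abs_zero]
    · rw [tTab_eq_zero₂ hr μ y _ (f' := (f, p.2)) h2, Rat.cast_zero, abs_zero]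
  · simp [blk_mixFFAt_eq_zero (toSite r) L κ u μ y hji]

/-- [folklore] **SUMMABILITY** of every block's fibre mass of the packed comb mixed table (finite support) — the `hPs` socket of
`StraightPinRestRow.restRow_K₀_of_blockSlotTotal`. -/
theorem summable_fibreMass_blk_mixFFAt (hr : r ∈ box (d + 1) L) (κ : Fin (d + 1)) (u : Fin (d + 1) → ℤ) (μ : Fin (d + 1))
    (y : Fin (d + 1) → ℤ) (j i : Bool) :
    Summable fun p : Site (d + 1) × Site (d + 1) => ∑ g : Fin (d + 1), ∑ f : Fin (d + 1), |blk (mixFFAt (toSite r) L κ u μ y) j i p.1 p.2 g f| :=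
  summable_of_ne_finset_zero fun _ hp => fibreMass_blk_mixFFAt_eq_zero hr κ u μ y j i hp

/-- [folklore] The full fibre mass of a block of the packed comb mixed table is the finite sum over `near(y) × near(y)`. -/
theorem tsum_fibreMass_blk_mixFFAt_eq (hr : r ∈ box (d + 1) L) (κ : Fin (d + 1)) (u : Fin (d + 1) → ℤ) (μ : Fin (d + 1))
    (y : Fin (d + 1) → ℤ) (j i : Bool) :
    ∑' p : Site (d + 1) × Site (d + 1), ∑ g : Fin (d + 1), ∑ f : Fin (d + 1), |blk (mixFFAt (toSite r) L κ u μ y) j i p.1 p.2 g f|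
      = ∑ p ∈ (nearSet (d + 1) L).image (fun x₀ => x₀ + (L : ℤ) • y) ×ˢ (nearSet (d + 1) L).image (fun x₀ => x₀ + (L : ℤ) • y),
          ∑ g : Fin (d + 1), ∑ f : Fin (d + 1), |blk (mixFFAt (toSite r) L κ u μ y) j i p.1 p.2 g f| :=
  tsum_eq_sum fun _ hp => fibreMass_blk_mixFFAt_eq_zero hr κ u μ y j i hp

/-- [folklore] **THE FINE-BLOCK × FULL-FIBRE MASS OF THE FIELD–FIELD BLOCK IS AT MOST node 12b's REFERENCE-BLOCK ABSOLUTE SUM `mixAbs`** — read as what it IS, an `ℓ¹` total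
(`Σ_μ Σ_{(f,f′,g) ∈ bondSet³} |t_{(μ,0)}(f,f′;g)|`), NOT as an entrywise bound: for every coarse site `y₁`,
`Σ_{b ∈ box} Σ_{(x,x′) ∈ near(y)²} Σ_{α α′} |t_{(μ,y)}((α,x),(α′,x′);(κ, L•y₁ + b))| ≤ mixAbs ρ L` (block covariance `tTab_eq_zero_block` to the block `0`; the map
`(b, x, x′, α, α′) ↦ ((α, x − L•y), (α′, x′ − L•y), (κ, L•(y₁ − y) + b))` is injective; terms with the background bond off the support box vanish by `tTab_eq_zero₃`). -/
theorem boxSum_fibreMass_tt_le_mixAbs (hr : r ∈ box (d + 1) L) (κ : Fin (d + 1)) (μ : Fin (d + 1)) (y₁ y : Fin (d + 1) → ℤ) :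
    ∑ b ∈ box (d + 1) L,
        ∑ p ∈ (nearSet (d + 1) L).image (fun x₀ => x₀ + (L : ℤ) • y) ×ˢ (nearSet (d + 1) L).image (fun x₀ => x₀ + (L : ℤ) • y),
          ∑ g : Fin (d + 1), ∑ f : Fin (d + 1), |blk (mixFFAt (toSite r) L κ ((L : ℤ) • y₁ + toSite b) μ y) true true p.1 p.2 g f|
      ≤ mixAbs (toSite r) L := by
  classical
  -- the index set and the injection into bond triples at the block `0`
  set NS : Finset (Site (d + 1)) := (nearSet (d + 1) L).image (fun x₀ => x₀ + (L : ℤ) • y) with hNS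
  set I : Finset ((Fin (d + 1) → ℕ) × ((Site (d + 1) × Site (d + 1)) × (Fin (d + 1) × Fin (d + 1)))) :=
    box (d + 1) L ×ˢ ((NS ×ˢ NS) ×ˢ (Finset.univ ×ˢ Finset.univ)) with hI
  let Φ : (Fin (d + 1) → ℕ) × ((Site (d + 1) × Site (d + 1)) × (Fin (d + 1) × Fin (d + 1))) → (Bond (d + 1) × Bond (d + 1)) × Bond (d + 1) :=
    fun q => (((q.2.2.1, q.2.1.1 + -((L : ℤ) • y)), (q.2.2.2, q.2.1.2 + -((L : ℤ) • y))), (κ, (L : ℤ) • y₁ + toSite q.1 + -((L : ℤ) • y)))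
  let T : (Bond (d + 1) × Bond (d + 1)) × Bond (d + 1) → ℝ := fun t => |(tTab (toSite r) L μ 0 t.1.1 t.1.2 t.2 : ℝ)|
  have hT0 : ∀ t, 0 ≤ T t := fun t => abs_nonneg _
  -- Step 1: the nested sum is the sum of `T ∘ Φ` over `I`
  have h1 : ∑ b ∈ box (d + 1) L, ∑ p ∈ NS ×ˢ NS,
        ∑ g : Fin (d + 1), ∑ f : Fin (d + 1), |blk (mixFFAt (toSite r) L κ ((L : ℤ) • y₁ + toSite b) μ y) true true p.1 p.2 g f|
      = ∑ q ∈ I, T (Φ q) := by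
    symm
    simp only [hI, Finset.sum_product, T, Φ]
    refine Finset.sum_congr rfl fun b _ => Finset.sum_congr rfl fun x _ => Finset.sum_congr rfl fun x' _ => ?_
    refine Finset.sum_congr rfl fun g _ => Finset.sum_congr rfl fun f _ => ?_
    conv_rhs => rw [blk_mixFFAt_tt, tTab_eq_zero_block]
    rfl
  -- Step 2: `Φ` is injective on `I`
  have hinj : Set.InjOn Φ ↑I := by
    rintro ⟨b, ⟨x, x'⟩, ⟨α, α'⟩⟩ _ ⟨b₂, ⟨x₂, x₂'⟩, ⟨α₂, α₂'⟩⟩ _ h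
    simp only [Φ, Prod.mk.injEq] at h
    obtain ⟨⟨⟨hα, hx⟩, ⟨hα', hx'⟩⟩, -, hb⟩ := h
    have hx2 : x = x₂ := by simpa using hx
    have hx2' : x' = x₂' := by simpa using hx'
    have hb2 : toSite b = toSite b₂ := by simpa using hb
    have hb3 : b = b₂ := by
      funext i
      have := congrFun hb2 i
      simp only [toSite] at this
      exact_mod_cast this
    subst hα; subst hα'; subst hx2; subst hx2'; subst hb3
    rfl
  -- Step 3: sum over the image, drop the terms off `bondSet³`, compare with `mixAbs`
  have h2 : ∑ q ∈ I, T (Φ q) = ∑ t ∈ I.image Φ, T t := (Finset.sum_image hinj).symm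
  have h3 : ∑ t ∈ I.image Φ, T t = ∑ t ∈ (I.image Φ).filter (fun t => t ∈ (bondSet (d + 1) L ×ˢ bondSet (d + 1) L) ×ˢ bondSet (d + 1) L), T t := by
    refine (Finset.sum_filter_of_ne fun t ht hne => ?_).symm
    obtain ⟨q, hq, rfl⟩ := Finset.mem_image.1 ht
    rw [hI, Finset.mem_product, Finset.mem_product, Finset.mem_product] at hq
    obtain ⟨hb, ⟨hx, hx'⟩, -⟩ := hq
    rw [hNS, mem_image_nearSet'] at hx hx'
    simp only [Finset.mem_product, mem_bondSet, Φ]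
    refine ⟨⟨near_zero_iff.2 hx, near_zero_iff.2 hx'⟩, ?_⟩
    by_contra hg
    exact hne (by simp only [T, Φ]; rw [tTab_eq_zero₃ hr μ 0 _ _ hg, Rat.cast_zero, abs_zero])
  have h4 : ∑ t ∈ (I.image Φ).filter (fun t => t ∈ (bondSet (d + 1) L ×ˢ bondSet (d + 1) L) ×ˢ bondSet (d + 1) L), T t
      ≤ ∑ t ∈ (bondSet (d + 1) L ×ˢ bondSet (d + 1) L) ×ˢ bondSet (d + 1) L, T t :=
    Finset.sum_le_sum_of_subset_of_nonneg (fun t ht => (Finset.mem_filter.1 ht).2) fun t _ _ => hT0 t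
  have h5 : ∑ t ∈ (bondSet (d + 1) L ×ˢ bondSet (d + 1) L) ×ˢ bondSet (d + 1) L, T t ≤ mixAbs (toSite r) L := by
    rw [mixAbs]
    exact Finset.single_le_sum (f := fun ν : Fin (d + 1) => ∑ t ∈ (bondSet (d + 1) L ×ˢ bondSet (d + 1) L) ×ˢ bondSet (d + 1) L,
      |(tTab (toSite r) L ν 0 t.1.1 t.1.2 t.2 : ℝ)|) (fun _ _ => Finset.sum_nonneg fun _ _ => abs_nonneg _) (Finset.mem_univ μ)
  rw [← hNS] at *
  rw [h1, h2, h3]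
  exact h4.trans h5

/-- [folklore] **WHERE THE BACKGROUND BOND CAN SIT**: a fine site of the block `y₁` in the support box of the block `y` forces `0 ≤ y₁ − y ≤ 1` coordinatewise, so
`|y − y₁|₁ ≤ d + 1` (the table-free helper of g63's file, re-proved here under its own name). -/
theorem l1_sub_le_of_near_block {y₁ y : Fin (d + 1) → ℤ} {b : Fin (d + 1) → ℕ} (h : Near L y ((L : ℤ) • y₁ + toSite b)) (hL : 1 ≤ L)
    (hb : b ∈ box (d + 1) L) : l1 (y - y₁) ≤ (d : ℝ) + 1 := by
  have hb' : ∀ i, b i < L := by simpa [AffineAveraging.box, Fintype.mem_piFinset, Finset.mem_range] using hb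
  have hc : ∀ i, |((y - y₁) i : ℝ)| ≤ 1 := by
    intro i
    obtain ⟨h1, h2⟩ := h i
    have hi := hb' i
    simp only [Pi.add_apply, Pi.smul_apply, smul_eq_mul, toSite] at h1 h2
    have hL0 : (0 : ℤ) < L := by exact_mod_cast hL
    have k1 : 0 ≤ y₁ i - y i := by
      by_contra hk; push Not at hk
      have : (L : ℤ) * y₁ i + b i < L * y i := by nlinarith
      omega
    have k2 : y₁ i - y i ≤ 1 := by
      by_contra hk; push Not at hk
      have : (L : ℤ) * y i + (2 * L - 1) < L * y₁ i + b i := by nlinarith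
      omega
    rw [Pi.sub_apply, show (((y i - y₁ i : ℤ)) : ℝ) = -((y₁ i - y i : ℤ) : ℝ) by push_cast; ring, abs_neg]
    rw [abs_le]; norm_cast; constructor <;> omega
  calc l1 (y - y₁) = ∑ i : Fin (d + 1), |((y - y₁) i : ℝ)| := rfl
    _ ≤ ∑ _i : Fin (d + 1), (1 : ℝ) := Finset.sum_le_sum fun i _ => hc i
    _ = (d : ℝ) + 1 := by simp

/-- [folklore] **THE `hPB` SOCKET FOR node 12b's PACKED COMB MIXED TABLE, WITH THE TABLE's OWN TOTAL** (any root offset in the box, any `0 ≤ θ`): for every fine direction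
`κ`, coarse bond `(μ, y)`, coarse site `y₁` and block `(j, i)`,
`Σ_{b ∈ box} Σ'_{(x,x′)} Σ_{g f} |blk (mixFFAt ρ L κ (L•y₁ + b) μ y) j i x x′ g f| ≤ (if j ∧ i then mixAbs ρ L·e^{θ(d+1)} else 0)·e^{−θ|y − y₁|₁}`. -/
theorem boxSum_tsum_fibreMass_blk_mixFFAt_le (hL : 1 ≤ L) (hr : r ∈ box (d + 1) L) {θ : ℝ} (hθ : 0 ≤ θ) (κ μ : Fin (d + 1))
    (y₁ y : Fin (d + 1) → ℤ) (j i : Bool) :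
    ∑ b ∈ box (d + 1) L, (∑' p : Site (d + 1) × Site (d + 1),
        ∑ g : Fin (d + 1), ∑ f : Fin (d + 1), |blk (mixFFAt (toSite r) L κ ((L : ℤ) • y₁ + toSite b) μ y) j i p.1 p.2 g f|)
      ≤ (if j = true ∧ i = true then mixAbs (toSite r) L * Real.exp (θ * ((d : ℝ) + 1)) else 0) * Real.exp (-θ * l1 (y - y₁)) := by
  by_cases hji : j = true ∧ i = true
  · obtain ⟨rfl, rfl⟩ := hji
    rw [if_pos ⟨rfl, rfl⟩]
    simp_rw [tsum_fibreMass_blk_mixFFAt_eq hr]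
    by_cases H : ∃ b ∈ box (d + 1) L, Near L y ((L : ℤ) • y₁ + toSite b)
    · obtain ⟨b₀, hb₀, hnear⟩ := H
      have hd := l1_sub_le_of_near_block hnear hL hb₀
      have hA := mixAbs_nonneg (toSite r) L
      have hexp : 1 ≤ Real.exp (θ * ((d : ℝ) + 1)) * Real.exp (-θ * l1 (y - y₁)) := by
        rw [← Real.exp_add]; exact Real.one_le_exp (by nlinarith)
      calc _ ≤ mixAbs (toSite r) L := boxSum_fibreMass_tt_le_mixAbs hr κ μ y₁ y
        _ ≤ mixAbs (toSite r) L * (Real.exp (θ * ((d : ℝ) + 1)) * Real.exp (-θ * l1 (y - y₁))) := le_mul_of_one_le_right hA hexp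
        _ = _ := by ring
    · push Not at H
      have h0 : ∑ b ∈ box (d + 1) L,
          ∑ p ∈ (nearSet (d + 1) L).image (fun x₀ => x₀ + (L : ℤ) • y) ×ˢ (nearSet (d + 1) L).image (fun x₀ => x₀ + (L : ℤ) • y),
            ∑ g : Fin (d + 1), ∑ f : Fin (d + 1), |blk (mixFFAt (toSite r) L κ ((L : ℤ) • y₁ + toSite b) μ y) true true p.1 p.2 g f| = 0 := by
        refine Finset.sum_eq_zero fun b hb => Finset.sum_eq_zero fun p _ => Finset.sum_eq_zero fun g _ => Finset.sum_eq_zero fun f _ => ?_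
        rw [blk_mixFFAt_tt, tTab_eq_zero₃ hr μ y _ _ (g := (κ, (L : ℤ) • y₁ + toSite b)) (H b hb), Rat.cast_zero, abs_zero]
      rw [h0]
      exact mul_nonneg (mul_nonneg (mixAbs_nonneg _ _) (Real.exp_pos _).le) (Real.exp_pos _).le
  · rw [if_neg hji, zero_mul]
    refine le_of_eq (Finset.sum_eq_zero fun b _ => ?_)
    simp [blk_mixFFAt_eq_zero (toSite r) L κ _ μ y hji]

end Table

/-! ## §2 `d = 3`, the comb table at the centred root: the `hPs ∕ hPB` sockets of `StraightPinRestRow.restRow_K₀_of_blockSlotTotal` INHABITED with the table's own total `mixAbs ρ_c n` -/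

section Record

variable (n : ℕ) [NeZero n]

/-- [folklore] **`hPs` AT THE COMB TABLE**: every block's fibre mass of `mixFFAt (ctr 4 n) n κ u ρ′ w` is summable in the site pair (finite support; `ctr 4 n = toSite (ctrOff 4 n)` is `rfl`). -/
theorem hPs_comb :
    ∀ (κ : Fin (3 + 1)) (u : Fin (3 + 1) → ℤ) (ρ' : Fin (3 + 1)) (w : Fin (3 + 1) → ℤ) (j i : Bool),
      Summable fun p : Site 4 × Site 4 => ∑ g, ∑ f, |blk (mixFFAt (ctr 4 n) n κ u ρ' w) j i p.1 p.2 g f| :=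
  fun κ u ρ' w j i => summable_fibreMass_blk_mixFFAt (ctrOff_mem_box (Nat.one_le_iff_ne_zero.2 (NeZero.ne n))) κ u ρ' w j i

/-- [folklore] **`hPB` AT THE COMB TABLE, WITH THE TABLE's OWN TOTAL** (`0 ≤ θ` free): for every fine direction `κ`, coarse bond `(ρ′, w)`, coarse site `y₁`, block `(j, i)`,
`Σ_{b ∈ box 4 n} Σ'_{(x,x′)} Σ_{g f} |blk (mixFFAt ρ_c n κ (n•y₁ + b) ρ′ w) j i x x′ g f| ≤ T j i · e^{−θ|w − y₁|₁}`, **`T j i := if j ∧ i then mixAbs ρ_c n·e^{4θ} else 0`**. -/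
theorem hPB_comb {θ : ℝ} (hθ : 0 ≤ θ) :
    ∀ (κ ρ' : Fin (3 + 1)) (y₁ w : Fin (3 + 1) → ℤ) (j i : Bool), ∑ b ∈ box (3 + 1) n,
      (∑' p : Site 4 × Site 4, ∑ g, ∑ f, |blk (mixFFAt (ctr 4 n) n κ ((n : ℤ) • y₁ + toSite b) ρ' w) j i p.1 p.2 g f|)
        ≤ (if j = true ∧ i = true then mixAbs (ctr 4 n) n * Real.exp (θ * ((3 : ℝ) + 1)) else 0) * Real.exp (-θ * l1 (w - y₁)) :=
  fun κ ρ' y₁ w j i => boxSum_tsum_fibreMass_blk_mixFFAt_le (Nat.one_le_iff_ne_zero.2 (NeZero.ne n))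
    (ctrOff_mem_box (Nat.one_le_iff_ne_zero.2 (NeZero.ne n))) hθ κ ρ' y₁ w j i

/-! ## §3 The (rest) pair AT THE COMB TABLE on the MASS route: the table priced by its own total, coarse rate `n`-FREE -/

/-- [our objects + folklore] **«COMB-REST-ROW-MASS» — THE (rest) PAIR AT THE COMB TABLE WITH THE TABLE COUNT READ IN `ℓ¹`** (modulo the displayed leg letter `Bdd G S`, `0 ≤ S`, the
multiplier envelope `hΦ`, and a free coarse rate `0 < θ`): for `Wrest a e z := ½·tadpole G (mixOfK K₀ n M₂ᶜ a 0 e z + mixOfK K₀ n M₂ᶜ e z a 0)`, `M₂ᶜ := mixFFAt (ctr 4 n) n`,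
(i) `∀ a e, AbsMoment₂ (Wrest a e)`; (ii) `|secondMoment Wrest μ ν| ≤ ½·(S·(2·K^{mix}_{K₀}(θ)·(mixAbs ρ_c n·e^{4θ})))·Σ'_x |x|₁² e^{−min (m₀∕8) (θ∕2)|x|₁}`,
`K^{mix}_{K₀}(θ) = (n⁵)⁻¹·((n⁵)⁻¹·(n³)⁻¹)·(16·C₄e^{κ′}·CΦe^{κ₀}·e^{m₀}·e^{m₀}·Zl 4 (m₀∕8)·Zl 4 (θ∕2))`, `m₀ = min κ′ κ₀`, `κ′ = kappa163 4∕4` — g62 `restRow_K₀_of_blockSlotTotal` fed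
with §2; g63 `restRow_record_mass`'s right-hand side VERBATIM with `symMixAbs ↦ mixAbs`.  The n-law of `mixAbs (ctr 4 n) n` is NOT asserted here (d1-leaf-04's `MixedTableMass`). -/
theorem restRow_comb_mass {G : MKer 4 (Fib 3)} {S : ℝ} (hG : Bdd G S) (hS : 0 ≤ S) {CΦ κ₀ : ℝ} (hκ₀ : 0 < κ₀)
    (hΦ : ∀ (ρ ν : Fin (3 + 1)) (w : Fin (3 + 1) → ℤ),
      |wΦ (N := n) ρ ν w| ≤ CΦ * ((n : ℝ) ^ 5)⁻¹ * ((n : ℝ) ^ 3)⁻¹ * Real.exp (-(κ₀ * supNorm w)))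
    {θ : ℝ} (hθ : 0 < θ) (μ ν : Fin (3 + 1)) :
    (∀ a e : Fin (3 + 1), AbsMoment₂ (fun z : Site 4 => (1 / 2 : ℝ) * tadpole G
        (mixOfK (KInvStep (d := 3) n 0) n (mixFFAt (ctr 4 n) n) a 0 e z
          + mixOfK (KInvStep (d := 3) n 0) n (mixFFAt (ctr 4 n) n) e z a 0))) ∧
      |B12Beta.secondMoment (fun (a e : Fin (3 + 1)) (z : Site 4) => (1 / 2 : ℝ) * tadpole G
          (mixOfK (KInvStep (d := 3) n 0) n (mixFFAt (ctr 4 n) n) a 0 e z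
            + mixOfK (KInvStep (d := 3) n 0) n (mixFFAt (ctr 4 n) n) e z a 0)) μ ν|
        ≤ ((1 / 2 : ℝ) * (S * (2 * ((((n : ℝ) ^ 5)⁻¹ * (((n : ℝ) ^ 5)⁻¹ * ((n : ℝ) ^ 3)⁻¹))
            * (16 * ((MG163 4 * periodConst (kappa163 4) 3) * Real.exp (kappa163 4 / 4)) * (CΦ * Real.exp κ₀)
                * Real.exp (min (kappa163 4 / 4) κ₀) * Real.exp (min (kappa163 4 / 4) κ₀)
                * Zl 4 (min (kappa163 4 / 4) κ₀ / 8) * Zl 4 (θ / 2)))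
            * (mixAbs (ctr 4 n) n * Real.exp (θ * ((3 : ℝ) + 1))))))
          * ∑' x : Site 4, l1 x ^ 2 * Real.exp (-(min (min (kappa163 4 / 4) κ₀ / 8) (θ / 2)) * l1 x) := by
  set T : Bool → Bool → ℝ := fun j i => if j = true ∧ i = true then mixAbs (ctr 4 n) n * Real.exp (θ * ((3 : ℝ) + 1)) else 0 with hT
  have hPB : ∀ (κ ρ' : Fin (3 + 1)) (y₁ w : Fin (3 + 1) → ℤ) (j i : Bool), ∑ b ∈ box (3 + 1) n,
      (∑' p : Site 4 × Site 4, ∑ g, ∑ f, |blk (mixFFAt (ctr 4 n) n κ ((n : ℤ) • y₁ + toSite b) ρ' w) j i p.1 p.2 g f|)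
        ≤ T j i * Real.exp (-θ * l1 (w - y₁)) := hPB_comb n hθ.le
  have h := restRow_K₀_of_blockSlotTotal n hG hS hκ₀ hΦ hθ (hPs_comb n) hPB μ ν
  have e : (T true true + T true false) + (T false true + T false false) = mixAbs (ctr 4 n) n * Real.exp (θ * ((3 : ℝ) + 1)) := by
    simp [hT]
  rw [e] at h
  exact h

/-! ## §4 The (rest) pair AT THE HEAD's LITERAL LEG `G₀ := coDressKBmAt (ctr 4 n) n K₀`: every constant CLOSED modulo the ff letter `hΓ` and `hΦ` -/

/-- [our objects + folklore] **«COMB-REST-ROW-HEAD» — THE (rest) PAIR AT THE COMB TABLE AND AT ITS OWN LEG, ALL SOCKETS FED BY TERM** (modulo the (K)-wall's ff letter `hΓ` (`0 ≤ CΓ`,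
`0 ≤ δΓ`), the multiplier envelope `hΦ`, and a free coarse rate `0 < θ`): §3 `restRow_comb_mass` with the leg letter `hG := bdd_G₀_of_decays n (decays_K₀_of_blocks n …)`:
`S = (1 + 4·(4·n))²·(CΓ + 2·(n⁵)⁻¹C₄e^{κ′} + CΦ(n⁵)⁻¹(n³)⁻¹e^{κ₀})`.  NET `n⁻¹³·(1+16n)²·(CΓ + …)·mixAbs ρ_c n·CΦ ×` n-FREE numbers at an n-FREE rate — g63 `restRow_head`'s
right-hand side VERBATIM with `symMixAbs ↦ mixAbs`.  Asserts NO n-law of `CΓ`, `CΦ`, `mixAbs`. -/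
theorem restRow_comb_head {CΓ δΓ : ℝ} (hCΓ : 0 ≤ CΓ) (hδΓ : 0 ≤ δΓ)
    (hΓ : ∀ (κ : Fin (3 + 1)) (x : Site 4) (l : Fin (3 + 1)) (x' : Site 4),
      |Gam (N := n) κ x l x'| ≤ CΓ * Real.exp (-δΓ * l1 (x - x')))
    {CΦ κ₀ : ℝ} (hκ₀ : 0 < κ₀)
    (hΦ : ∀ (ρ ν : Fin (3 + 1)) (w : Fin (3 + 1) → ℤ),
      |wΦ (N := n) ρ ν w| ≤ CΦ * ((n : ℝ) ^ 5)⁻¹ * ((n : ℝ) ^ 3)⁻¹ * Real.exp (-(κ₀ * supNorm w)))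
    {θ : ℝ} (hθ : 0 < θ) (μ ν : Fin (3 + 1)) :
    (∀ a e : Fin (3 + 1), AbsMoment₂ (fun z : Site 4 => (1 / 2 : ℝ) * tadpole (coDressKBmAt (ctr 4 n) n (KInvStep (d := 3) n 0))
        (mixOfK (KInvStep (d := 3) n 0) n (mixFFAt (ctr 4 n) n) a 0 e z
          + mixOfK (KInvStep (d := 3) n 0) n (mixFFAt (ctr 4 n) n) e z a 0))) ∧
      |B12Beta.secondMoment (fun (a e : Fin (3 + 1)) (z : Site 4) => (1 / 2 : ℝ) * tadpole (coDressKBmAt (ctr 4 n) n (KInvStep (d := 3) n 0))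
          (mixOfK (KInvStep (d := 3) n 0) n (mixFFAt (ctr 4 n) n) a 0 e z
            + mixOfK (KInvStep (d := 3) n 0) n (mixFFAt (ctr 4 n) n) e z a 0)) μ ν|
        ≤ ((1 / 2 : ℝ) * (((1 + 4 * (((3 : ℝ) + 1) * n)) ^ 2
              * (CΓ + (((n : ℝ) ^ 5)⁻¹ * ((MG163 4 * periodConst (kappa163 4) 3) * Real.exp (kappa163 4 / 4)))
                  + (((n : ℝ) ^ 5)⁻¹ * ((MG163 4 * periodConst (kappa163 4) 3) * Real.exp (kappa163 4 / 4)))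
                  + (CΦ * ((n : ℝ) ^ 5)⁻¹ * ((n : ℝ) ^ 3)⁻¹ * Real.exp κ₀)))
            * (2 * ((((n : ℝ) ^ 5)⁻¹ * (((n : ℝ) ^ 5)⁻¹ * ((n : ℝ) ^ 3)⁻¹))
            * (16 * ((MG163 4 * periodConst (kappa163 4) 3) * Real.exp (kappa163 4 / 4)) * (CΦ * Real.exp κ₀)
                * Real.exp (min (kappa163 4 / 4) κ₀) * Real.exp (min (kappa163 4 / 4) κ₀)
                * Zl 4 (min (kappa163 4 / 4) κ₀ / 8) * Zl 4 (θ / 2)))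
            * (mixAbs (ctr 4 n) n * Real.exp (θ * ((3 : ℝ) + 1))))))
          * ∑' x : Site 4, l1 x ^ 2 * Real.exp (-(min (min (kappa163 4 / 4) κ₀ / 8) (θ / 2)) * l1 x) := by
  have hG := bdd_G₀_of_decays n (decays_K₀_of_blocks n hCΓ hΓ hκ₀ hΦ)
    (le_min hδΓ (le_min (by have := kappa163_pos 4; positivity) (by positivity)))
  have hS : 0 ≤ (1 + 4 * (((3 : ℝ) + 1) * n)) ^ 2
      * (CΓ + (((n : ℝ) ^ 5)⁻¹ * ((MG163 4 * periodConst (kappa163 4) 3) * Real.exp (kappa163 4 / 4)))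
          + (((n : ℝ) ^ 5)⁻¹ * ((MG163 4 * periodConst (kappa163 4) 3) * Real.exp (kappa163 4 / 4)))
          + (CΦ * ((n : ℝ) ^ 5)⁻¹ * ((n : ℝ) ^ 3)⁻¹ * Real.exp κ₀)) :=
    (abs_nonneg _).trans (hG 0 0 (Sum.inl 0) (Sum.inl 0))
  exact restRow_comb_mass n hG hS hκ₀ hΦ hθ μ ν

end Record

end Summit.QuantumFields.BalabanUV.Beta.D1BFx.CombStraightPinRestRowMass

end
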